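import Literature.MathematicalPhysics.QuantumFieldTheory.Balaban1983to89.Beta.RemainderDelta2Tower
import Literature.MathematicalPhysics.QuantumFieldTheory.Balaban1983to89.Beta.RemainderOriginTowerPlaquetteLocalSup

/-!
# T. Bałaban, *The variational problem and background fields in renormalization group method for lattice gauge theories*, Commun. Math. Phys. **102** (1985)
# 277–309 [Balaban1985Variational] (182) p. 307, (190) p. 308, read against [Balaban1985BackgroundPropagators] (3.126) p. 420, (3.132)–(3.138) pp. 422–423:
# **NODE D OF ROW (D4) AT THE ORIGIN ON PRINT's SMALL-FIELD CLASS WITH BAŁABAN's OWN `Δ⁽²⁾(U)` BUILT IN — NO `Δ⁽²⁾` LETTER** — the value END «Y13a»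
# `exists_ineq190_origin_tower_plaquette_localSup` composed with «Y17c» `exists_delta2_tower`: the LAST displayed analytic letter `hD2` of NODE D at the
# origin is GONE; `Δ⁽²⁾` is the operator of (3.134) ∕ (3.136) at the top level of NE9's tower, its (3.137) the theorem of «Y17b∕c» («Y18», row (D4) OWNER
# lineage `b2b-balaban-beta-an4`, gen 114)

CITATION HEADER (lean-in-tree rule 2026-08-18).  Audit cell `pub-balaban`, BINDER row (D4) (`RemainderConst` leaves for Bałaban's split), OWNER lineage
`b2b-balaban-beta-an4`, gen 114.  Loci as in «Y13a» and «Y17a∕b∕c» (this gen): [Balaban1985Variational] (B11 = [15]; held `paper:balaban1985-cmp102-variational-background`,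
journal page = PDF page + 276) (129)–(131) pp. 297–298, (180) p. 306, (182) p. 307, (190) p. 308; [Balaban1985BackgroundPropagators] (B9 = [5];
`paper:balaban1985-cmp99-background-propagators`, journal page = PDF page + 388) (3.11) p. 392, (3.15) p. 393, (3.35)–(3.37) p. 396, Thm 3.1 (3.42) p. 397, Thm 3.3
p. 399, Thm 3.11 p. 416, (3.126) p. 420, (3.132)–(3.138) pp. 422–423 (pp. 422–423 re-read first-hand this generation); [Balaban1985Averaging] (B7 = [4]) (52) p. 26,
(122) p. 36, (136)–(138), (141) p. 39, (145) p. 39, (149) p. 40, (155) p. 41; [Balaban1984PropagatorsII] (B6 = [3]) (2.51)–(2.52) p. 232, Lemma 2.1 (2.61) p. 234.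
Composed BY NAME: «Y13a» §4 and «Y17c» (whose (K81) binder block — ne9-leaf-05's `B9Eq3126H1kPiSupRowClosed` — is repeated VERBATIM).  Nothing of print is
asserted here.

WHY THIS FILE («Y18»).  **`exists_ineq190_origin_tower_delta2`**: `∃ (α⋆, B, δ, A′, r₁, α₁, j₁, Λ)` FIRST; then under (K81)'s binder block (the diagonal
`n, η, c₀, c₁`, weights, period `m`, the background `U` with `star U = U⁻¹` in print's windows `αη`, `αη²`, `αη²` and the CURRENT WINDOW (3.36) `‖J‖ ≤ j₀ ≤ j₁`,
`α ≤ α₁`, the consumer's display ∕ witnesses `αU, hα1, hαL, hU1, hreg, hpos′, hpos, hposπ, hQ`, the level profile, transporters, `hc₀η : c₀ = η^d`), `α ≤ α⋆`,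
geometry and rates, [4] Prop. 5's smallnesses `(α₀, β)` displayed at the top, and the derived constants at their closed forms with `λ₀ := Λ·j₀`, `r_D := d` and the
two smallnesses `q, q_I < 1` (now smallnesses of `j₀`, i.e. of print's (3.36) window): **THERE ARE `Δ⁽²⁾` (= «Y17c»'s operator of (3.134)), `G′ = (Δ_{a,k}(U) −
Δ⁽²⁾)⁻¹` and `(Q_kG′Q_k†)⁻¹` two-sided, with `∀ δ′, δ′∕8 ≤ ρ → Ineq190 S^{coarse}_m S^{fine}_m (H₀ + G̃Δ⁽²⁾H₀) (A₀ + B_G̃θ_Dc) δ′`**, `H₀ = H₁,k(U)` the consumer's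
term — [15] (182) `(δ∕δB)𝓗(0) = H₀ + G̃Δ⁽²⁾H₀` with (190) at the origin, EVERY operator Bałaban's (on the cell's model), NO displayed analytic letter except
printed-shape windows and smallnesses.

HONEST SCOPE.  One `obtain` of «Y13a» + one of «Y17c»; NO estimate proved here; what stays displayed is of PRINTED SHAPE only: print's windows (3.35) read
GLOBALLY on the torus + the current window (3.36), [4] Prop. 5's smallnesses ((145), (155), `4β < c₃`, exp; (52) derived), the weights `ρ_w`, the
Hilbert-structure letters, the consumer's display ∕ witnesses, the two smallnesses in `j₀`.  A MODEL result on the one-domain tower `Ω_k = T_η` of NE9's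
carriers (ONE level `j = k`): NOT Bałaban's multiscale `{Ω_j}`∕`𝔅` setting, NOT `Δ⁽²⁾_π` (3.135), NOT (3.138) for `G₁`∕`H₁`, NOT (189), NOT the `Data190`
plumbing; the divergence ∕ slice-gradient lines follow the same way from «Y13b∕c».  Row (D4) class UNCHANGED (instance 0∕1; critical-path width 0 = NODE O; D4
DISCHARGE NO DATE); NOT B12 Thm 2, NOT BetaPertH, NOT continuum, NOT Clay.  HONEST DEPENDENCY (cell line): continuum YM on T⁴ ⇐ BetaPertH ∧ nine spine estimates
(0/9 proved); BetaPertH ⇐ (D1) ∧ (D4) ∧ CAP+tail; G-an2-4 gates asym, D1 and NE2/3/4.  NEW file; nothing modified; 0 `def`; standard axioms; no `sorry`;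
`maxHeartbeats 400000` on the one theorem (the merged binder block).  Net new unproved facts: 0.
-/

noncomputable section

set_option autoImplicit false

open scoped BigOperators InnerProductSpace ComplexConjugate

namespace Literature.MathematicalPhysics.QuantumFieldTheory.Balaban1983to89.Beta.RemainderOriginTowerDelta2

open B11SectG B11SupSize190
open B9Eq311L2Pairing (WL2)
open B4Sect5Torus (TSite tdist)
open B4Sect5Proof (latticeConst)
open B5TorusCover (UT)
open B9Thm34Ext (toB6)
open B9Thm37GlueTorus (torusGeom tdist1)
open B9SectCLatticeCarrier (Bond bpos btgt unshift)
open B9Eq319QprimeTorus (fineP blockCoord)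
open B7Prop1Explicit (U1 Wcx boxVec)
open B7Prop2Explicit (unitaryUnits mem_unitaryUnits pdev C0 c2')
open B7Prop3Flat (c3)
open B7Prop5GeneralLevels (thetaGen C3Gen)
open B11Eq103H1Complex (SiteL2K BondL2K H1LatticeK)
open B9Eq310DeltaPrime (plaqHolU)
open B9Eq310HessianOperator (adTransportW)
open B9Eq315QTorus (perCfg perCfg_apply cornerSite)
open B9Eq315QTower (towerP UlevOf)
open B9Eq316TowerFlatIsOneStep (towerP_eq_fineP_pow siteCast)
open B9Eq326OperatorTower (QkW laplaceAk G1k H1k)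
open B9Eq324DeltaPrimeATower (laplacePrimeAk)
open B9Eq3119DeltaPiTower (laplaceAkPi)
open Beta.RemainderOriginTowerPlaquetteLocalSup (exists_ineq190_origin_tower_plaquette_localSup)
open Beta.RemainderDelta2Tower (exists_delta2_tower)

section Tower

variable {d : ℕ} (hd : 1 ≤ d) (L : ℕ) [NeZero L] (hL : 1 ≤ L) (hL3 : 3 ≤ L)
  {𝔸 : Type*} [CStarAlgebra 𝔸] [Nontrivial 𝔸]
  {W : Type} [NormedAddCommGroup W] [InnerProductSpace ℂ W] [FiniteDimensional ℂ W] (φ : W ≃ₗ[ℂ] 𝔸)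
  {Mφ Mφ' : ℝ} (hMφ : 0 ≤ Mφ) (hMφ' : 0 ≤ Mφ') (hφ : ∀ w, ‖φ w‖ ≤ Mφ * ‖w‖) (hφ' : ∀ X, ‖φ.symm X‖ ≤ Mφ' * ‖X‖) (hstar : ∀ X : 𝔸, ‖star X‖ ≤ ‖X‖)
  {a : ℝ} (ha : 0 < a) {a' : ℝ} (ha' : 0 < a') {ϱ : ℝ} (hϱ0 : 0 ≤ ϱ) (hϱ1 : ϱ < 1)
  (τ : 𝔸 →ₗ[ℂ] ℂ) {Cτ : ℝ} (hτ : ∀ X, ‖τ X‖ ≤ Cτ * ‖X‖) (hCτ : 0 ≤ Cτ) {Mτ : ℝ} (hτm : ∀ X Y : 𝔸, ‖τ (X * Y)‖ ≤ Mτ * ‖X‖ * ‖Y‖) (hMτ : 0 ≤ Mτ)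
  {ρw : ℝ} (hρw : 0 ≤ ρw)
  (hτ₁ : ∀ X : 𝔸, τ (star X) = conj (τ X)) (hτ₂ : ∀ X Y : 𝔸, τ (X * Y) = τ (Y * X)) (hφτ : ∀ X Y : 𝔸, ⟪φ.symm X, φ.symm Y⟫_ℂ = τ (star X * Y))
  (AQ : ℝ)
  (hAQ16 : 16 * ((d : ℝ) + 1) * ((d : ℝ) + 4) * c2' d L ≤ AQ)
  {α₀ β : ℝ} (hα : 0 < α₀) (hα3 : C0 d * α₀ ≤ 1 / 3) (hα4 : 4 * α₀ ≤ c2' d L) (hβ : 0 < β)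
  (hsmall : Real.exp (4 * (800 * ((d : ℝ) + 1) ^ 2 * ((d : ℝ) + 4)) * α₀) * (1 + 8 * (131072 * ((d : ℝ) + 1) ^ 2) * β) ≤ 2)
  (hc₃ : 4 * β < c3 d L)
  (h145 : 8 * d * thetaGen d L α₀ * (L : ℝ)⁻¹ ^ 4 ≤ 1)
  (h155 : (2 * (L : ℝ) - 1) * (L : ℝ)⁻¹ ^ 2 + 2 * d * thetaGen d L α₀ * (L : ℝ)⁻¹ ^ 3
    + 1 / 8 * (1 + 2 * d * thetaGen d L α₀ * (L : ℝ)⁻¹ ^ 2 + 2 * d * C3Gen d L * β) * (L : ℝ)⁻¹ ^ 2 ≤ 1)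

set_option maxHeartbeats 400000 in
include hd hL hL3 hMφ hMφ' hφ hφ' hstar ha ha' hϱ0 hϱ1 hτ hCτ hτm hMτ hρw hτ₁ hτ₂ hφτ hAQ16 hα hα3 hα4 hβ hsmall hc₃ h145 h155 in
/-- **NODE D OF ROW (D4) AT THE ORIGIN WITH BAŁABAN's `Δ⁽²⁾(U)` BUILT IN** — see the module docstring: «Y13a» §4 with its `(Δ⁽²⁾, λ₀, r_D, hD2)` binders
DISCHARGED by «Y17c» (`λ₀ = Λ·j₀`, `r_D = d`): `∃ (α⋆, B, δ, A′, r₁, α₁, j₁, Λ)` first; under the merged binder block, `∃ Δ⁽²⁾ G′ Inv′` with the two-sided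
inverse relations and `∀ δ′, δ′∕8 ≤ ρ → Ineq190 S^{coarse}_m S^{fine}_m (H₀ + G̃Δ⁽²⁾H₀) (A₀ + B_G̃θ_Dc) δ′`, `H₀ = H₁,k(U)` the consumer's term.
[cite: Balaban1985Variational, (182) p.307, (190) p.308, (129)–(131) pp.297–298, (180) p.306] [cite: Balaban1985BackgroundPropagators, (3.134)–(3.138) pp.422–423,
(3.126) p.420, (3.132)–(3.133) p.422, Thm 3.1 (3.42) p.397, Thm 3.11 p.416, (3.35)–(3.37) p.396] [cite: Balaban1985Averaging, (136)–(138) p.39, (149) p.40, (52) p.26,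
(145) p.39, (155) p.41] [cite: Balaban1984PropagatorsII, (2.51)–(2.52) p.232, Lemma 2.1 (2.61) p.234] -/
theorem exists_ineq190_origin_tower_delta2 :
    ∃ αs B δ A' r₁ α₁ j₁ Λ : ℝ, 0 < αs ∧ 0 ≤ B ∧ 0 < δ ∧ 0 ≤ A' ∧ 0 < r₁ ∧ 0 < α₁ ∧ 0 < j₁ ∧ 0 ≤ Λ ∧
      ∀ (n : ℕ) (η : ℝ) (_hηL : η * (L : ℝ) ^ (n + 1) = 1) (c₀ c₁ : ℝ) [Fact (0 < c₀)] [Fact (0 < c₁)]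
        (_hw : c₀ * ((L : ℝ) ^ (n + 1)) ^ d = c₁) (_hρ : |η| ^ d / c₀ ≤ ρw) (m : Fin d → ℕ) [∀ i, NeZero (m i)] (_hm : ∀ i, 1 ≤ m i)
        (U : Bond d (towerP L m (n + 1)) → 𝔸ˣ) (αU : ℕ → ℝ) (_hα0 : ∀ j, 0 ≤ αU j) (hα1 : ∀ j, αU j ≤ 1 / 64)
        (hαL : ∀ j, 50 * (d + 1) * αU j * (L : ℝ) ^ d ≤ 1 / 2)
        (hU1 : ∀ (j : ℕ) (x : B7Prop1Explicit.Site d) (k : Fin d), perCfg (towerP L m (j + 1)) (UlevOf L m (n + 1) U j) x k ∈ U1 𝔸)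
        (hreg : ∀ (j : ℕ) (y : TSite d (towerP L m j)) (k : Fin d) (ρ' : Fin d → Fin L),
          ‖((Wcx L (perCfg (towerP L m (j + 1)) (UlevOf L m (n + 1) U j)) (cornerSite L y) k (boxVec L ρ') : 𝔸ˣ) : 𝔸) - 1‖ ≤ αU j)
        (εU : ℕ → ℝ) (_hεU : ∀ j, 0 ≤ εU j) (_hUε : ∀ (j : ℕ) (b : Bond d (towerP L m (j + 1))), ‖(UlevOf L m (n + 1) U j b : 𝔸) - 1‖ ≤ εU j)
        (_hLb : ∀ (j : ℕ) (b : Bond d (towerP L m (j + 1))), UlevOf L m (n + 1) U j b ∈ U1 𝔸)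
        (α : ℝ) (_hα : 0 ≤ α) (_hαle : α ≤ α₁)
        (hUst : ∀ b, star (U b : 𝔸) = (((U b)⁻¹ : 𝔸ˣ) : 𝔸)) (_hUb : ∀ b, U b ∈ U1 𝔸) (_hUη : ∀ b, ‖(U b : 𝔸) - 1‖ ≤ α * η)
        (_hpl : ∀ p : B9SectCLatticeCarrier.Plaq d (towerP L m (n + 1)), ‖(plaqHolU U p : 𝔸) - 1‖ ≤ α * η ^ 2)
        (_hUgrad : ∀ (x : TSite d (towerP L m (n + 1))) (μ : Fin d), ‖(U (x, μ) : 𝔸) - U (unshift μ x, μ)‖ ≤ α * η ^ 2)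
        (_hRlev : ∀ (j : ℕ) (b : Bond d (towerP L m (j + 1))) (w : W), ‖adTransportW φ (UlevOf L m (n + 1) U j) b w‖ ≤ ‖w‖)
        (_hεg : ∀ j < n + 1, εU j ≤ α * ϱ ^ j) (_hAQ : ∑ j ∈ Finset.range (n + 1), αU j ≤ AQ)
        (hpos' : ∀ x : SiteL2K ℂ d (towerP L m (n + 1)) c₀ W, x ≠ 0 → 0 < RCLike.re ⟪x, laplacePrimeAk L m n φ η U a' (c₁ := c₁) x⟫_ℂ)
        (hpos : ∀ x : BondL2K ℂ d (towerP L m (n + 1)) c₀ W, x ≠ 0 →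
          0 < RCLike.re ⟪x, laplaceAk L m n φ η U hL αU hα1 hU1 hreg τ (c₀ := c₀) (c₁ := c₁) a x⟫_ℂ)
        (_hc₀η : c₀ = η ^ d) (j₀ : ℝ) (_hJ : ∀ μ y, ‖B9Eq39Adjoint.J (fun μ => B9Eq33CovDerivVector.shiftEquiv μ) (fun μ y => U (y, μ)) η μ y‖ ≤ j₀) (_hj : j₀ ≤ j₁)
        (hposπ : ∀ x : BondL2K ℂ d (towerP L m (n + 1)) c₀ W, x ≠ 0 →
          0 < RCLike.re ⟪x, laplaceAkPi L m n φ τ η U a' hpos' hL αU hα1 hU1 hreg (c₁ := c₁) a x⟫_ℂ)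
        (hQ : Function.Surjective (QkW L m n φ U hL αU hα1 hU1 hreg (c₀ := c₀) (c₁ := c₁)))
        (_hαs : α ≤ αs)
        (η₀ L₀ M₀ R : ℝ) (H : Prop)
        -- the rates and the (free) row-sum constant
        (ρ σ c : ℝ) (_hσ : 0 < σ) (_hρ0 : 0 ≤ ρ) (_hρ₁ : ρ + 5 * σ ≤ δ / d) (_hρI : ρ + 5 * σ ≤ r₁ / d) (_hc_def : c = B6.c0 1 σ ^ d)
    -- the derived constants, bound to their closed forms (instantiate with `rfl`; `λ = λ₀·e^{σ r_D}·c`), and the TWO smallnesses in `λ₀`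
    {q BG' θP qI BI' A₀ θD BGt : ℝ}
    (hq_def : q = B * ((Λ * j₀) * Real.exp (σ * d) * c) * Real.exp (δ / d * d) * c) (hq : q < 1) (hBG' : BG' = B * (1 - q)⁻¹)
    (hθP : θP = B * ((Λ * j₀) * Real.exp (σ * d) * c) * Real.exp (δ / d * d) * BG' * c *
      ((Mφ' * Real.exp (100 * d * (d + 1) * (L : ℝ) ^ d * AQ) * Mφ * ((2 * d : ℕ) : ℝ)) * Real.exp 1 * latticeConst d 1) *
      Real.exp ((ρ + 4 * σ) * d) * ((Mφ' * Mφ * Real.exp (50 * (d + 1) * AQ)) * Real.exp 1 * latticeConst d 1) *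
      Real.exp ((ρ + 4 * σ) * d))
    (hqI : qI = A' * θP * c * c) (hqI1 : qI < 1) (hBI' : BI' = A' * (1 - qI)⁻¹)
    (hA₀ : A₀ = B * ((Mφ' * Real.exp (100 * d * (d + 1) * (L : ℝ) ^ d * AQ) * Mφ * ((2 * d : ℕ) : ℝ)) * Real.exp 1 *
      latticeConst d 1) * Real.exp δ * A' * c)
    (hθD : θD = A₀ * ((Λ * j₀) * Real.exp (σ * d) * c) * Real.exp (ρ * d))
    (hBGt : BGt = BG' + ((Mφ' * Mφ * Real.exp (50 * (d + 1) * AQ)) * Real.exp 1 * latticeConst d 1) *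
      ((Mφ' * Real.exp (100 * d * (d + 1) * (L : ℝ) ^ d * AQ) * Mφ * ((2 * d : ℕ) : ℝ)) * Real.exp 1 * latticeConst d 1) *
      BI' * BG' * BG' * Real.exp ((ρ + 2 * σ) * d) * Real.exp ((ρ + 2 * σ) * d) * c * c),
    ∃ D2 : BondL2K ℂ d (towerP L m (n + 1)) c₀ W →ₗ[ℂ] BondL2K ℂ d (towerP L m (n + 1)) c₀ W,
    ∃ (G' : (Bond d (towerP L m (n + 1)) → W) →L[ℂ] (Bond d (towerP L m (n + 1)) → W))
      (Inv' : (Bond d m → W) →L[ℂ] (Bond d m → W)),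
      -- `G′ = (Δ_{a,k}(U) − Δ⁽²⁾)⁻¹`, two-sided
      G' * (LinearMap.toContinuousLinearMap
          ((WL2.linearEquiv ℂ ℂ (fun _ : Bond d (towerP L m (n + 1)) => c₀) :
              BondL2K ℂ d (towerP L m (n + 1)) c₀ W ≃ₗ[ℂ] (Bond d (towerP L m (n + 1)) → W)).toLinearMap ∘ₗ
            laplaceAk L m n φ η U hL αU hα1 hU1 hreg τ (c₀ := c₀) (c₁ := c₁) a ∘ₗ
            (WL2.linearEquiv ℂ ℂ (fun _ : Bond d (towerP L m (n + 1)) => c₀) :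
              BondL2K ℂ d (towerP L m (n + 1)) c₀ W ≃ₗ[ℂ] (Bond d (towerP L m (n + 1)) → W)).symm.toLinearMap) -
        LinearMap.toContinuousLinearMap
          ((WL2.linearEquiv ℂ ℂ (fun _ : Bond d (towerP L m (n + 1)) => c₀) :
              BondL2K ℂ d (towerP L m (n + 1)) c₀ W ≃ₗ[ℂ] (Bond d (towerP L m (n + 1)) → W)).toLinearMap ∘ₗ D2 ∘ₗ
            (WL2.linearEquiv ℂ ℂ (fun _ : Bond d (towerP L m (n + 1)) => c₀) :
              BondL2K ℂ d (towerP L m (n + 1)) c₀ W ≃ₗ[ℂ] (Bond d (towerP L m (n + 1)) → W)).symm.toLinearMap)) = 1 ∧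
      (LinearMap.toContinuousLinearMap
          ((WL2.linearEquiv ℂ ℂ (fun _ : Bond d (towerP L m (n + 1)) => c₀) :
              BondL2K ℂ d (towerP L m (n + 1)) c₀ W ≃ₗ[ℂ] (Bond d (towerP L m (n + 1)) → W)).toLinearMap ∘ₗ
            laplaceAk L m n φ η U hL αU hα1 hU1 hreg τ (c₀ := c₀) (c₁ := c₁) a ∘ₗ
            (WL2.linearEquiv ℂ ℂ (fun _ : Bond d (towerP L m (n + 1)) => c₀) :
              BondL2K ℂ d (towerP L m (n + 1)) c₀ W ≃ₗ[ℂ] (Bond d (towerP L m (n + 1)) → W)).symm.toLinearMap) -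
        LinearMap.toContinuousLinearMap
          ((WL2.linearEquiv ℂ ℂ (fun _ : Bond d (towerP L m (n + 1)) => c₀) :
              BondL2K ℂ d (towerP L m (n + 1)) c₀ W ≃ₗ[ℂ] (Bond d (towerP L m (n + 1)) → W)).toLinearMap ∘ₗ D2 ∘ₗ
            (WL2.linearEquiv ℂ ℂ (fun _ : Bond d (towerP L m (n + 1)) => c₀) :
              BondL2K ℂ d (towerP L m (n + 1)) c₀ W ≃ₗ[ℂ] (Bond d (towerP L m (n + 1)) → W)).symm.toLinearMap)) * G' = 1 ∧
      -- `Inv′ = (Q_kG′Q_k†)⁻¹`, two-sided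
      Inv' * ((LinearMap.toContinuousLinearMap
          ((WL2.linearEquiv ℂ ℂ (fun _ : Bond d m => c₁) : BondL2K ℂ d m c₁ W ≃ₗ[ℂ] (Bond d m → W)).toLinearMap ∘ₗ
            QkW L m n φ U hL αU hα1 hU1 hreg (c₀ := c₀) (c₁ := c₁) ∘ₗ
            (WL2.linearEquiv ℂ ℂ (fun _ : Bond d (towerP L m (n + 1)) => c₀) :
              BondL2K ℂ d (towerP L m (n + 1)) c₀ W ≃ₗ[ℂ] (Bond d (towerP L m (n + 1)) → W)).symm.toLinearMap)).comp
        (G'.comp (LinearMap.toContinuousLinearMap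
          ((WL2.linearEquiv ℂ ℂ (fun _ : Bond d (towerP L m (n + 1)) => c₀) :
              BondL2K ℂ d (towerP L m (n + 1)) c₀ W ≃ₗ[ℂ] (Bond d (towerP L m (n + 1)) → W)).toLinearMap ∘ₗ
            LinearMap.adjoint (QkW L m n φ U hL αU hα1 hU1 hreg (c₀ := c₀) (c₁ := c₁)) ∘ₗ
            (WL2.linearEquiv ℂ ℂ (fun _ : Bond d m => c₁) : BondL2K ℂ d m c₁ W ≃ₗ[ℂ] (Bond d m → W)).symm.toLinearMap)))) = 1 ∧
      ((LinearMap.toContinuousLinearMap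
          ((WL2.linearEquiv ℂ ℂ (fun _ : Bond d m => c₁) : BondL2K ℂ d m c₁ W ≃ₗ[ℂ] (Bond d m → W)).toLinearMap ∘ₗ
            QkW L m n φ U hL αU hα1 hU1 hreg (c₀ := c₀) (c₁ := c₁) ∘ₗ
            (WL2.linearEquiv ℂ ℂ (fun _ : Bond d (towerP L m (n + 1)) => c₀) :
              BondL2K ℂ d (towerP L m (n + 1)) c₀ W ≃ₗ[ℂ] (Bond d (towerP L m (n + 1)) → W)).symm.toLinearMap)).comp
        (G'.comp (LinearMap.toContinuousLinearMap
          ((WL2.linearEquiv ℂ ℂ (fun _ : Bond d (towerP L m (n + 1)) => c₀) :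
              BondL2K ℂ d (towerP L m (n + 1)) c₀ W ≃ₗ[ℂ] (Bond d (towerP L m (n + 1)) → W)).toLinearMap ∘ₗ
            LinearMap.adjoint (QkW L m n φ U hL αU hα1 hU1 hreg (c₀ := c₀) (c₁ := c₁)) ∘ₗ
            (WL2.linearEquiv ℂ ℂ (fun _ : Bond d m => c₁) : BondL2K ℂ d m c₁ W ≃ₗ[ℂ] (Bond d m → W)).symm.toLinearMap)))) * Inv' = 1 ∧
      -- the (190) letter of `H₀ + G̃Δ⁽²⁾H₀`, `H₀ = H₁,k(U)` by name, `G̃ = G′ − G′Q_k†·Inv′·Q_kG′`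
      ∀ δ' : ℝ, δ' / 8 ≤ ρ →
        Ineq190
          (supSize (toB6 (torusGeom m η₀ L₀ M₀) R H)
            (fun y => Finset.univ.filter fun c : Bond d m => bpos c = UT.toSite m y)
            (fun c => UT.ofSite m (bpos c)) : BlockNorm (toB6 (torusGeom m η₀ L₀ M₀) R H) (Bond d m → W))
          (supSize (toB6 (torusGeom m η₀ L₀ M₀) R H)
            (fun y => Finset.univ.filter fun b : Bond d (towerP L m (n + 1)) =>
              blockCoord (L ^ (n + 1)) m (siteCast (towerP_eq_fineP_pow L m (n + 1)) (bpos b)) = UT.toSite m y)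
            (fun b => UT.ofSite m (blockCoord (L ^ (n + 1)) m (siteCast (towerP_eq_fineP_pow L m (n + 1)) (bpos b)))) :
              BlockNorm (toB6 (torusGeom m η₀ L₀ M₀) R H) (Bond d (towerP L m (n + 1)) → W))
          ((((WL2.linearEquiv ℂ ℂ (fun _ : Bond d (towerP L m (n + 1)) => c₀) :
                  BondL2K ℂ d (towerP L m (n + 1)) c₀ W ≃ₗ[ℂ] (Bond d (towerP L m (n + 1)) → W)).toLinearMap ∘ₗ
              H1k L m n φ η U hL αU hα1 hU1 hreg τ (c₀ := c₀) (c₁ := c₁) hαL hpos ∘ₗ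
              (WL2.linearEquiv ℂ ℂ (fun _ : Bond d m => c₁) : BondL2K ℂ d m c₁ W ≃ₗ[ℂ] (Bond d m → W)).symm.toLinearMap).restrictScalars ℝ) +
            ((G'.restrictScalars ℝ : (Bond d (towerP L m (n + 1)) → W) →ₗ[ℝ] (Bond d (towerP L m (n + 1)) → W)) -
              ((G'.restrictScalars ℝ : (Bond d (towerP L m (n + 1)) → W) →ₗ[ℝ] (Bond d (towerP L m (n + 1)) → W)) ∘ₗ
                (((WL2.linearEquiv ℂ ℂ (fun _ : Bond d (towerP L m (n + 1)) => c₀) :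
                      BondL2K ℂ d (towerP L m (n + 1)) c₀ W ≃ₗ[ℂ] (Bond d (towerP L m (n + 1)) → W)).toLinearMap ∘ₗ
                  LinearMap.adjoint (QkW L m n φ U hL αU hα1 hU1 hreg (c₀ := c₀) (c₁ := c₁)) ∘ₗ
                  (WL2.linearEquiv ℂ ℂ (fun _ : Bond d m => c₁) : BondL2K ℂ d m c₁ W ≃ₗ[ℂ] (Bond d m → W)).symm.toLinearMap).restrictScalars ℝ)) ∘ₗ
              (Inv'.restrictScalars ℝ : (Bond d m → W) →ₗ[ℝ] (Bond d m → W)) ∘ₗ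
              ((((WL2.linearEquiv ℂ ℂ (fun _ : Bond d m => c₁) : BondL2K ℂ d m c₁ W ≃ₗ[ℂ] (Bond d m → W)).toLinearMap ∘ₗ
                  QkW L m n φ U hL αU hα1 hU1 hreg (c₀ := c₀) (c₁ := c₁) ∘ₗ
                  (WL2.linearEquiv ℂ ℂ (fun _ : Bond d (towerP L m (n + 1)) => c₀) :
                    BondL2K ℂ d (towerP L m (n + 1)) c₀ W ≃ₗ[ℂ] (Bond d (towerP L m (n + 1)) → W)).symm.toLinearMap).restrictScalars ℝ) ∘ₗ
                (G'.restrictScalars ℝ : (Bond d (towerP L m (n + 1)) → W) →ₗ[ℝ] (Bond d (towerP L m (n + 1)) → W)))) ∘ₗ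
            ((((WL2.linearEquiv ℂ ℂ (fun _ : Bond d (towerP L m (n + 1)) => c₀) :
                    BondL2K ℂ d (towerP L m (n + 1)) c₀ W ≃ₗ[ℂ] (Bond d (towerP L m (n + 1)) → W)).toLinearMap ∘ₗ D2 ∘ₗ
                (WL2.linearEquiv ℂ ℂ (fun _ : Bond d (towerP L m (n + 1)) => c₀) :
                  BondL2K ℂ d (towerP L m (n + 1)) c₀ W ≃ₗ[ℂ] (Bond d (towerP L m (n + 1)) → W)).symm.toLinearMap).restrictScalars ℝ) ∘ₗ
              (((WL2.linearEquiv ℂ ℂ (fun _ : Bond d (towerP L m (n + 1)) => c₀) :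
                    BondL2K ℂ d (towerP L m (n + 1)) c₀ W ≃ₗ[ℂ] (Bond d (towerP L m (n + 1)) → W)).toLinearMap ∘ₗ
                H1k L m n φ η U hL αU hα1 hU1 hreg τ (c₀ := c₀) (c₁ := c₁) hαL hpos ∘ₗ
                (WL2.linearEquiv ℂ ℂ (fun _ : Bond d m => c₁) : BondL2K ℂ d m c₁ W ≃ₗ[ℂ] (Bond d m → W)).symm.toLinearMap).restrictScalars ℝ)))
          (A₀ + BGt * θD * c) δ' := by
  obtain ⟨αs, B, δ, A', r₁, hαs, hB, hδ, hA', hr₁, HY⟩ :=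
    exists_ineq190_origin_tower_plaquette_localSup hd L hL hL3 φ hMφ hMφ' hφ hφ' ha ha' τ hτ hCτ hτm hMτ hρw hτ₁ hτ₂ hφτ AQ hAQ16
  obtain ⟨α₁, j₁, Λ, hα₁, hj₁, hΛ, HD⟩ :=
    exists_delta2_tower hd L hL hL3 φ hMφ hMφ' hφ hφ' hstar ha ha' hϱ0 hϱ1 τ hτ hCτ hτm hMτ hρw hτ₁ hτ₂ hφτ AQ hα hα3 hα4 hβ hsmall hc₃ h145 h155
  refine ⟨αs, B, δ, A', r₁, α₁, j₁, Λ, hαs, hB, hδ, hA', hr₁, hα₁, hj₁, hΛ, ?_⟩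
  intro n η hηL c₀ c₁ _ _ hw hρ m _ hm U αU hα0 hα1 hαL hU1 hreg εU hεU hUε hLb α hα' hαle hUst hUb hUη hpl hUgrad hRlev hεg hAQ hpos' hpos hc₀η j₀ hJ hj
    hposπ hQ hαs' η₀ L₀ M₀ R H ρ σ c hσ hρ0 hρ₁ hρI hc_def q BG' θP qI BI' A₀ θD BGt hq_def hq hBG' hθP hqI hqI1 hBI' hA₀ hθD hBGt
  obtain ⟨D2, hD2, -⟩ := HD n η hηL c₀ c₁ hw hρ m hm U αU hα0 hα1 hαL hU1 hreg εU hεU hUε hLb α hα' hαle hUst hUb hUη hpl hUgrad hRlev hεg hAQ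
    hpos' hpos hc₀η j₀ hJ hj hposπ hQ
  -- `U` is unitary-valued (from `star U = U⁻¹`), and `0 ≤ j₀`
  have hUu : ∀ b, U b ∈ unitaryUnits 𝔸 := fun b => by
    rw [mem_unitaryUnits, Unitary.mem_iff]
    exact ⟨by rw [hUst, Units.inv_mul], by rw [hUst, Units.mul_inv]⟩
  have hj0 : 0 ≤ j₀ := (norm_nonneg _).trans (hJ ⟨0, hd⟩ (fun _ => 0))
  exact ⟨D2, HY n η hηL c₀ c₁ hw hρ m hm U hUu α hα' hαs' hUη hpl hUgrad αU hα1 hαL hU1 hreg hpos η₀ L₀ M₀ R H ρ σ c hσ hρ0 hρ₁ hρI hc_def D2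
    (lam₀ := Λ * j₀) (rD := d) (mul_nonneg hΛ hj0) hD2 hq_def hq hBG' hθP hqI hqI1 hBI' hA₀ hθD hBGt⟩

end Tower

end Literature.MathematicalPhysics.QuantumFieldTheory.Balaban1983to89.Beta.RemainderOriginTowerDelta2

end
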